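import Mathlib.Analysis.SpecialFunctions.Integrals.Basic
import Literature.Analysis.FluidPDE.StretchedLayerNSBurgers
import HarnessLib

/-!
# Pointwise bounds for the Burgers vortex layer: erf minorants, speed, and the gradient at the layer

Cell `ns-blowup`, seat `ns-blowup-ecbridge-4` (g6; D-0074 GROUP C «BRIDGE SUPPORT»; bears_on LADDER-NS N1,
route `PalasekTowerBreakdown`, crux `EpisodeBase` = item stmt-NavierStokesRegularity-19179, line `slot`, stub
`first_episode`; supports / evidence only, nothing claimed). VOCABULARY-SIDE CALCULUS for the level-1 READ-OUT
of the crux idea «orthogonal-seed-contact-strain» (planner seat `ns-plan-lens-profile` g0, 19179 evidence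
#47/#48), which reads the grown level as a Burgers vortex LAYER; the register arithmetic itself is the
companion file `PalasekTowerBurgersLayerReadout.lean`. Everything here is about the Literature objects
`burgersLayerProfile γ ν ΔU = V` (`V(s) = (ΔU/√π) ∫₀^{κ s} e^{−t²} dt`, `κ = (γ/2ν)^{1/2}`,
`BurgersVortexLayer.lean`), `burgersLayer γ ν ΔU = (−γx₀, V(x₀), γx₂)`, `burgersLayerProfileD = V'`
(`BurgersVortexLayerSteady.lean`, with the shear calculus `StrainedShear.hasFDerivAt_shear`) and the range
bound `|V| ≤ ΔU/2` (`StretchedLayerNSBurgers.lean`), all reused by name: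

* Gaussian-primitive minorants from `1 − t² ≤ e^{−t²}`: `b − b³/3 ≤ ∫₀^b e^{−t²} dt` (`b ≥ 0`) and
  `2/3 ≤ ∫₀^b e^{−t²} dt` (`b ≥ 1`); hence `V(s) ≥ (2/3)ΔU/√π` once `κs ≥ 1`, and the signed near-layer
  bound `s·V(s) ≥ (ΔU/√π)(κs² − κ³s⁴/3)` for all real `s` (`ΔU ≥ 0`);
* the components and the speed of the layer, `‖u(x)‖² = γ²(x₀² + x₂²) + V(x₀)²` (strain ⟂ shear);
* the full derivative `Du(x) = diag(−γ, 0, γ) + V'(x₀) dx₀ ⊗ e₁` (`hasFDerivAt_burgersLayer`), its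
  entry `(Du(x) e₀)₁ = V'(x₀)`, and the consequence `V'(x₀) ≤ ‖Du(x)‖` (operator norm), in particular
  `ΔU κ/√π ≤ ‖Du(x)‖` on the centre plane `x₀ = 0` (`burgersLayerProfileD_zero`).

LABEL: MODEL-side calculus on an exact, steady, infinite-energy profile. WHAT THIS IS NOT: not Navier–Stokes
evidence — nothing about any registered stage, `FirstEpisodeD`, `RungG 1`, `EpisodeBaseG` or blow-up.
References: J. M. Burgers, Adv. Appl. Mech. 1 (1948) 171–199; Th. Gallay, C. E. Wayne, arXiv:math/0503353,
(1.1) [GallayWayne2006]; A. J. Majda, A. L. Bertozzi, *Vorticity and Incompressible Flow*, CUP 2002, §1.4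
Ex. 1.8 [MajdaBertozziCUP2002]. All statements are [folklore] calculus.
-/

noncomputable section

open Set Function Filter Topology WithLp MeasureTheory intervalIntegral
open scoped ContDiff

namespace Summit.NavierStokesRegularity.FluidComputer.PalasekTowerClayBridge

open Literature.Analysis.FluidPDE StrainedShear

/-! ### Minorants of the Gaussian primitive -/

/-- A polynomial minorant of the Gaussian primitive: `b − b³/3 ≤ ∫₀^b e^{−t²} dt` for `b ≥ 0`
(integrate `1 − t² ≤ e^{−t²}`). [folklore] -/
theorem sub_cube_le_integral_exp_neg_sq {b : ℝ} (hb : 0 ≤ b) :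
    b - b ^ 3 / 3 ≤ ∫ t in (0 : ℝ)..b, Real.exp (-t ^ 2) := by
  have h1 : ∫ t in (0 : ℝ)..b, ((1 : ℝ) - t ^ 2) = b - b ^ 3 / 3 := by
    rw [intervalIntegral.integral_sub intervalIntegrable_const
      ((continuous_pow 2).intervalIntegrable _ _)]
    norm_num [integral_pow]
  rw [← h1]
  exact intervalIntegral.integral_mono_on hb
    (intervalIntegrable_const.sub ((continuous_pow 2).intervalIntegrable _ _))
    (continuous_exp_neg_sq.intervalIntegrable _ _)
    fun t _ => by linarith [Real.add_one_le_exp (-t ^ 2)]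

/-- `2/3 ≤ ∫₀^b e^{−t²} dt` for `b ≥ 1` (monotonicity in `b` and the minorant at `b = 1`). [folklore] -/
theorem two_thirds_le_integral_exp_neg_sq {b : ℝ} (hb : 1 ≤ b) :
    2 / 3 ≤ ∫ t in (0 : ℝ)..b, Real.exp (-t ^ 2) := by
  have h1 : (2 : ℝ) / 3 ≤ ∫ t in (0 : ℝ)..1, Real.exp (-t ^ 2) := by
    have := sub_cube_le_integral_exp_neg_sq zero_le_one
    norm_num at this
    exact this
  refine h1.trans ?_
  exact intervalIntegral.integral_mono_interval le_rfl zero_le_one hb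
    (Eventually.of_forall fun t => (Real.exp_pos _).le)
    (continuous_exp_neg_sq.intervalIntegrable _ _)

/-! ### Bounds on the profile -/

/-- `V(s)² ≤ (ΔU/2)²` (`γ, ν > 0`, `ΔU ≥ 0`; from `abs_burgersLayerProfile_le`). [folklore] -/
theorem burgersLayerProfile_sq_le {γ ν ΔU : ℝ} (hγ : 0 < γ) (hν : 0 < ν) (hΔU : 0 ≤ ΔU) (s : ℝ) :
    burgersLayerProfile γ ν ΔU s ^ 2 ≤ (ΔU / 2) ^ 2 := by
  have h := abs_burgersLayerProfile_le hγ hν hΔU s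
  have h' : |burgersLayerProfile γ ν ΔU s| ≤ |ΔU / 2| :=
    h.trans (le_abs_self _)
  exact sq_le_sq.2 h'

/-- **Lower bound away from the layer**: `V(s) ≥ (2/3)·ΔU/√π` once `κ s ≥ 1` (`ΔU ≥ 0`). [folklore] -/
theorem burgersLayerProfile_ge_of_one_le {γ ν ΔU s : ℝ} (hΔU : 0 ≤ ΔU)
    (hs : 1 ≤ burgersLayerRate γ ν * s) :
    ΔU / Real.sqrt Real.pi * (2 / 3) ≤ burgersLayerProfile γ ν ΔU s := by
  unfold burgersLayerProfile
  exact mul_le_mul_of_nonneg_left (two_thirds_le_integral_exp_neg_sq hs) (by positivity)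

/-- **Lower bound near the layer, signed form**: `s·V(s) ≥ (ΔU/√π)(κs² − κ³s⁴/3)` for every real `s`
(`ΔU ≥ 0`, `γ, ν > 0`; both sides are even in `s`, and for `s ≥ 0` this is
`V(s) ≥ (ΔU/√π)(κs − (κs)³/3)`). [folklore] -/
theorem mul_burgersLayerProfile_ge {γ ν ΔU : ℝ} (hγ : 0 < γ) (hν : 0 < ν) (hΔU : 0 ≤ ΔU) (s : ℝ) :
    ΔU / Real.sqrt Real.pi *
        (burgersLayerRate γ ν * s ^ 2 - burgersLayerRate γ ν ^ 3 * s ^ 4 / 3) ≤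
      s * burgersLayerProfile γ ν ΔU s := by
  have hκ := burgersLayerRate_pos hγ hν
  set κ := burgersLayerRate γ ν with hκdef
  have hc : 0 ≤ ΔU / Real.sqrt Real.pi := by positivity
  have key : ∀ r : ℝ, 0 ≤ r →
      ΔU / Real.sqrt Real.pi * (κ * r - (κ * r) ^ 3 / 3) ≤ burgersLayerProfile γ ν ΔU r := by
    intro r hr
    unfold burgersLayerProfile
    exact mul_le_mul_of_nonneg_left (sub_cube_le_integral_exp_neg_sq (by positivity)) hc
  rcases le_or_gt 0 s with hs | hs
  · have h := mul_le_mul_of_nonneg_left (key s hs) hs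
    calc ΔU / Real.sqrt Real.pi * (κ * s ^ 2 - κ ^ 3 * s ^ 4 / 3)
        = s * (ΔU / Real.sqrt Real.pi * (κ * s - (κ * s) ^ 3 / 3)) := by ring
      _ ≤ s * burgersLayerProfile γ ν ΔU s := h
  · have h := mul_le_mul_of_nonneg_left (key (-s) (by linarith)) (by linarith : (0 : ℝ) ≤ -s)
    have hodd : burgersLayerProfile γ ν ΔU s = -burgersLayerProfile γ ν ΔU (-s) := by
      rw [burgersLayerProfile_neg, neg_neg]
    calc ΔU / Real.sqrt Real.pi * (κ * s ^ 2 - κ ^ 3 * s ^ 4 / 3)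
        = -s * (ΔU / Real.sqrt Real.pi * (κ * -s - (κ * -s) ^ 3 / 3)) := by ring
      _ ≤ -s * burgersLayerProfile γ ν ΔU (-s) := h
      _ = s * burgersLayerProfile γ ν ΔU s := by rw [hodd]; ring

/-- **The slope at the centre of the layer**: `V′(0) = ΔU κ/√π`. [folklore] -/
theorem burgersLayerProfileD_zero (γ ν ΔU : ℝ) :
    burgersLayerProfileD γ ν ΔU 0 = ΔU / Real.sqrt Real.pi * burgersLayerRate γ ν := by
  simp [burgersLayerProfileD]

/-! ### The layer field: components, speed, derivative -/

/-- Components of the Burgers layer `u = (−γx₀, V(x₀), γx₂)`. [folklore] -/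
theorem burgersLayer_apply_zero (γ ν ΔU : ℝ) (x : EuclideanSpace ℝ (Fin 3)) :
    burgersLayer γ ν ΔU x 0 = -γ * x 0 := by
  simp [burgersLayer, planeStrain]

/-- Components of the Burgers layer `u = (−γx₀, V(x₀), γx₂)`. [folklore] -/
theorem burgersLayer_apply_one (γ ν ΔU : ℝ) (x : EuclideanSpace ℝ (Fin 3)) :
    burgersLayer γ ν ΔU x 1 = burgersLayerProfile γ ν ΔU (x 0) := by
  simp [burgersLayer, planeStrain]

/-- Components of the Burgers layer `u = (−γx₀, V(x₀), γx₂)`. [folklore] -/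
theorem burgersLayer_apply_two (γ ν ΔU : ℝ) (x : EuclideanSpace ℝ (Fin 3)) :
    burgersLayer γ ν ΔU x 2 = γ * x 2 := by
  simp [burgersLayer, planeStrain]

/-- **Speed of the layer**: `‖u(x)‖² = γ²(x₀² + x₂²) + V(x₀)²` (strain and shear are orthogonal).
[folklore] -/
theorem norm_burgersLayer_sq (γ ν ΔU : ℝ) (x : EuclideanSpace ℝ (Fin 3)) :
    ‖burgersLayer γ ν ΔU x‖ ^ 2 =
      γ ^ 2 * (x 0 ^ 2 + x 2 ^ 2) + burgersLayerProfile γ ν ΔU (x 0) ^ 2 := by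
  rw [EuclideanSpace.norm_sq_eq]
  simp [Fin.sum_univ_three, burgersLayer_apply_zero, burgersLayer_apply_one, burgersLayer_apply_two]
  ring

/-- **The derivative of the Burgers layer**: `Du(x) = diag(−γ, 0, γ) + V'(x₀) dx₀ ⊗ e₁`
(`V' = burgersLayerProfileD`; `StrainedShear.hasFDerivAt_shear`). [folklore] -/
theorem hasFDerivAt_burgersLayer (γ ν ΔU : ℝ) (x : EuclideanSpace ℝ (Fin 3)) :
    HasFDerivAt (burgersLayer γ ν ΔU)
      (planeStrainL γ + ((burgersLayerProfileD γ ν ΔU (x 0)) •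
        (EuclideanSpace.proj 0 : EuclideanSpace ℝ (Fin 3) →L[ℝ] ℝ)).smulRight eOne) x := by
  rw [burgersLayer, burgersLayerVelocity_eq_shear, planeStrain_eq]
  exact (planeStrainL γ).hasFDerivAt.add
    (hasFDerivAt_shear (hasDerivAt_burgersLayerProfile' γ ν ΔU) x)

/-- The shear entry of the derivative: `(Du(x) e₀)₁ = V'(x₀)` (`e₀ = (1, 0, 0)`). [folklore] -/
theorem fderiv_burgersLayer_single_zero_apply_one (γ ν ΔU : ℝ) (x : EuclideanSpace ℝ (Fin 3)) :
    fderiv ℝ (burgersLayer γ ν ΔU) x (EuclideanSpace.single 0 1) 1 =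
      burgersLayerProfileD γ ν ΔU (x 0) := by
  rw [(hasFDerivAt_burgersLayer γ ν ΔU x).fderiv]
  simp [linearStrain, eOne]

/-- **The shear slope bounds the velocity gradient from below**: `V'(x₀) ≤ ‖Du(x)‖` (operator norm;
test vector `e₀`, read in the component `1`). [folklore] -/
theorem burgersLayerProfileD_le_norm_fderiv_burgersLayer (γ ν ΔU : ℝ) (x : EuclideanSpace ℝ (Fin 3)) :
    burgersLayerProfileD γ ν ΔU (x 0) ≤ ‖fderiv ℝ (burgersLayer γ ν ΔU) x‖ := by
  set L := fderiv ℝ (burgersLayer γ ν ΔU) x with hL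
  have he₀ : ‖(EuclideanSpace.single (0 : Fin 3) (1 : ℝ) : EuclideanSpace ℝ (Fin 3))‖ = 1 := by
    rw [EuclideanSpace.norm_eq]
    simp
  calc burgersLayerProfileD γ ν ΔU (x 0) = L (EuclideanSpace.single 0 1) 1 :=
        (fderiv_burgersLayer_single_zero_apply_one γ ν ΔU x).symm
    _ ≤ |L (EuclideanSpace.single 0 1) 1| := le_abs_self _
    _ = ‖L (EuclideanSpace.single 0 1) 1‖ := (Real.norm_eq_abs _).symm
    _ ≤ ‖L (EuclideanSpace.single 0 1)‖ := PiLp.norm_apply_le _ _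
    _ ≤ ‖L‖ * ‖(EuclideanSpace.single (0 : Fin 3) (1 : ℝ) : EuclideanSpace ℝ (Fin 3))‖ :=
        L.le_opNorm _
    _ = ‖L‖ := by rw [he₀, mul_one]

/-- On the centre plane the gradient is at least the peak slope: `ΔU κ/√π ≤ ‖Du(x)‖` for `x₀ = 0`.
[folklore] -/
theorem slope_le_norm_fderiv_burgersLayer {γ ν ΔU : ℝ} {x : EuclideanSpace ℝ (Fin 3)} (hx : x 0 = 0) :
    ΔU / Real.sqrt Real.pi * burgersLayerRate γ ν ≤ ‖fderiv ℝ (burgersLayer γ ν ΔU) x‖ := by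
  have h := burgersLayerProfileD_le_norm_fderiv_burgersLayer γ ν ΔU x
  rwa [hx, burgersLayerProfileD_zero] at h


end Summit.NavierStokesRegularity.FluidComputer.PalasekTowerClayBridge

end
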